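/-
Copyright (c) 2026. All rights reserved.
Released under Apache 2.0 license as described in the file LICENSE.
Authors: HodgeCM publication cell (pub-hodgecm), GR lane, seat GR-2 (`pub-hodgecm-own-hyp34`).
-/
import Literature.NumberTheory.Weil1964.ArchUnitaryWeilHalf3
import HarnessLib

/-!
# The Folland coordinates of the general frame `frame3` turn real-place weights into diagonal scalings

Sequel of `ArchUnitaryWeilHalf3` (the Folland frame `frame3` of `W_∞` for a general quadratic `E/F`).  A REAL-PLACE WEIGHT is a
vector `r : Fin N → F ⊗ ℝ` with `(r_j)_v = ρ_{v,j} ∈ ℝ` at the real places and `(r_j)_v = 1` at the complex places; it acts on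
`(F ⊗ ℝ)^N` coordinatewise.  Since `frame3` is coordinatewise (scalings at the real places, twists and `re`/`im` at the complex
places) and the trace pairing is symmetric under such weights, BOTH halves of the Folland coordinates
`Ξ(a, w) = (frame3 a, follandFreq frame3 (T_∞ w))` turn the weight into the diagonal scaling
`ε̃ = (ρ_{v,j} at the real coordinate (j, v), 1 at the complex coordinates)` of `ℝ^{FrameIdx}` — for every adelic Gram matrix
`T` with diagonal archimedean part (`archFolland_frame3_mul`; `frame3_mul`, `archMat_diagonal_map`).

Use: the sign elements of the Siegel parabolic at the split real places act through such weights (`ρ = ±1`), and the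
doubling element `δ` commutes with them (`GelbartRogawski1991/DoubledWeilRepresentationArchDeltaSign`).  Topic
`NumberTheory/Weil1964`; KERNEL ONLY: theorems; no definition, no `def … : Prop`, no `sorry`.

## References
* [Folland1989] G. B. Folland, *Harmonic Analysis in Phase Space*, Princeton UP 1989, §1.3 (1.25).
* [GelbartRogawski1991] S. Gelbart, J. Rogawski, Invent. math. 105 (1991), §3.1 p. 454.
* [CasselsFrohlichANT1967] J. W. S. Cassels, A. Fröhlich (eds.), *Algebraic Number Theory* (1967), Ch. II §14.
-/

set_option autoImplicit false

noncomputable section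

open scoped Matrix Real Classical ComplexConjugate
open Complex NumberField NumberField.InfinitePlace NumberField.mixedEmbedding IsDedekindDomain
open Literature.NumberTheory.Automorphic Literature.NumberTheory.Automorphic.UnitaryGroup
open Literature.RepresentationTheory.HeisenbergGroup Literature.Analysis.SegalBargmann

namespace Literature.NumberTheory.Weil1964

/-! ## §1 Diagonal matrices and weights -/

section Diag

/-- a diagonal matrix commutes with every weight scaling: `diag(d) (U · V) = U · (diag(d) V)`. [cite: Kudla1994, §3] -/
theorem diagonal_mulVec_mul {K m : Type*} [CommRing K] [Fintype m] [DecidableEq m] (d U V : m → K) :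
    Matrix.diagonal d *ᵥ (U * V) = U * (Matrix.diagonal d *ᵥ V) := by
  funext k
  simp only [Matrix.mulVec_diagonal, Pi.mul_apply]
  ring

end Diag

/-! ## §2 The frame and the Folland coordinates under real-place weights -/

section Frame

variable {F' : Type} [Field F'] [NumberField F'] (E' : Type) [Field E'] [NumberField E'] [Algebra F' E'] (c' : E' ≃ₐ[F'] E')
  (N' : ℕ) (hc' : c' ≠ 1) (p : {v : InfinitePlace F' // v.IsReal} → Prop)
  (wOf₁ : {v : {v : InfinitePlace F' // v.IsReal} // p v} → {w : InfinitePlace E' // w.IsComplex})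
  (hw₁ : ∀ k, c' • (wOf₁ k).1 = (wOf₁ k).1)
  (wOf : {v : InfinitePlace F' // v.IsComplex} → {w : InfinitePlace E' // w.IsComplex})
  (hover : ∀ v, (wOf v).1.comap (algebraMap F' E') = v.1)
  (t₀ : Fin N' → F') (ht0 : ∀ j, t₀ j ≠ 0) {δ' : E'} (hcδ' : c' δ' = -δ') (hδ' : δ' ≠ 0)
  (ρ : {v : InfinitePlace F' // v.IsReal} → Fin N' → ℝ)

omit [NumberField E'] in
/-- the archimedean part of `diag(t₀) ⊗ 1` is diagonal. [cite: Folland1989, §1.3 (1.25)] -/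
theorem archMat_diagonal_map :
    archMat F' (Fin N') ((Matrix.diagonal t₀).map (algebraMap F' (AdeleRing (𝓞 F') F'))) =
      Matrix.diagonal fun j => archMat F' (Fin N') ((Matrix.diagonal t₀).map (algebraMap F' (AdeleRing (𝓞 F') F'))) j j := by
  refine Matrix.ext fun i j => ?_
  by_cases hij : i = j
  · subst hij; rw [Matrix.diagonal_apply_eq]
  · rw [Matrix.diagonal_apply_ne _ hij]
    change InfiniteAdeleRing.ringEquiv_mixedSpace F' (((Matrix.diagonal t₀).map (algebraMap F' (AdeleRing (𝓞 F') F'))) i j).1 = 0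
    rw [Matrix.map_apply, Matrix.diagonal_apply_ne _ hij, map_zero]
    exact map_zero _

omit [NumberField E'] in
/-- **the frame turns the real-place weight `r_j = ((ρ_v)_j at real v, 1 at complex v)` into the diagonal scaling**
`ε̃ = (ρ_{v,j} at the real coordinate (j, v), 1 at the complex coordinates)`. [cite: Folland1989, §1.3 (1.25)] -/
theorem frame3_mul (a : Fin N' → mixedEmbedding.mixedSpace F') :
    frame3 E' c' N' hc' p wOf₁ hw₁ wOf hover t₀ ht0 hcδ' hδ'
        ((fun j => ((fun v => ρ v j, fun _ => (1 : ℂ)) : mixedEmbedding.mixedSpace F')) * a) =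
      Sum.elim (fun jv : Fin N' × {v : InfinitePlace F' // v.IsReal} => ρ jv.2 jv.1) (fun _ => (1 : ℝ)) *
        frame3 E' c' N' hc' p wOf₁ hw₁ wOf hover t₀ ht0 hcδ' hδ' a := by
  funext k
  rcases k with ⟨j, v⟩ | ⟨i | i, v⟩
  · rw [Pi.mul_apply, Sum.elim_inl, frame3, scaledFrameGenT_apply, scaledFrameGenT_apply, scaledFrameGen_apply_inl,
      scaledFrameGen_apply_inl, twistVec_apply_fst, twistVec_apply_fst, Pi.mul_apply, Prod.fst_mul, Pi.mul_apply]
    ring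
  · simp only [Pi.mul_apply, Sum.elim_inr, one_mul, frame3, scaledFrameGenT_apply, scaledFrameGen_apply_inr_inl,
      twistVec_apply_snd, Prod.snd_mul]
  · simp only [Pi.mul_apply, Sum.elim_inr, one_mul, frame3, scaledFrameGenT_apply, scaledFrameGen_apply_inr_inr,
      twistVec_apply_snd, Prod.snd_mul]

omit [NumberField E'] [Algebra F' E'] in
/-- the trace pairing is symmetric under weights: `⟨u, r·w⟩ = ⟨r·u, w⟩`. [cite: CasselsFrohlichANT1967, Ch. II §14] -/
theorem piTracePairing_mul_right (r u w : Fin N' → mixedEmbedding.mixedSpace F') :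
    piTracePairing F' (Fin N') u (r * w) = piTracePairing F' (Fin N') (r * u) w := by
  rw [piTracePairing_apply, piTracePairing_apply]
  refine Finset.sum_congr rfl fun i _ => ?_
  rw [Pi.mul_apply, Pi.mul_apply, mul_left_comm, mul_assoc]

omit [NumberField F'] [NumberField E'] [Algebra F' E'] in
/-- two vectors with the same dot products against all frame vectors are equal. [cite: Folland1989, §1.3 (1.25)] -/
theorem eq_of_forall_dotProduct_frame_eq {σ : Type} [Fintype σ] [DecidableEq σ]
    (fr : (Fin N' → mixedEmbedding.mixedSpace F') ≃L[ℝ] (σ → ℝ)) {x y : σ → ℝ} (h : ∀ u, x ⬝ᵥ fr u = y ⬝ᵥ fr u) : x = y := by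
  funext k
  have h1 := h (fr.symm (Pi.single k 1))
  rwa [ContinuousLinearEquiv.apply_symm_apply, dotProduct_single, dotProduct_single, mul_one, mul_one] at h1

omit [NumberField E'] in
/-- **the Folland coordinates turn the real-place weight into the diagonal scaling** (both halves: the frame half by
`frame3_mul`, the frequency half by the defining property of `follandFreq` and the symmetry of the trace pairing), for any
adelic Gram matrix `T` with diagonal archimedean part. [cite: Folland1989, §1.3 (1.25); GelbartRogawski1991, §3.1 p. 454] -/
theorem archFolland_frame3_mul (T : Matrix (Fin N') (Fin N') (AdeleRing (𝓞 F') F')) (dT : Fin N' → mixedEmbedding.mixedSpace F')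
    (hT : archMat F' (Fin N') T = Matrix.diagonal dT) (a w : Fin N' → mixedEmbedding.mixedSpace F') :
    archFolland T (frame3 E' c' N' hc' p wOf₁ hw₁ wOf hover t₀ ht0 hcδ' hδ')
        ((fun j => ((fun v => ρ v j, fun _ => (1 : ℂ)) : mixedEmbedding.mixedSpace F')) * a,
         (fun j => ((fun v => ρ v j, fun _ => (1 : ℂ)) : mixedEmbedding.mixedSpace F')) * w) =
      (Sum.elim (fun jv : Fin N' × {v : InfinitePlace F' // v.IsReal} => ρ jv.2 jv.1) (fun _ => (1 : ℝ)) *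
          (archFolland T (frame3 E' c' N' hc' p wOf₁ hw₁ wOf hover t₀ ht0 hcδ' hδ') (a, w)).1,
       Sum.elim (fun jv : Fin N' × {v : InfinitePlace F' // v.IsReal} => ρ jv.2 jv.1) (fun _ => (1 : ℝ)) *
          (archFolland T (frame3 E' c' N' hc' p wOf₁ hw₁ wOf hover t₀ ht0 hcδ' hδ') (a, w)).2) := by
  set r : Fin N' → mixedEmbedding.mixedSpace F' := fun j => ((fun v => ρ v j, fun _ => (1 : ℂ)) : mixedEmbedding.mixedSpace F')
    with hr
  set εt : FrameIdx F' (Fin N') → ℝ := Sum.elim (fun jv : Fin N' × {v : InfinitePlace F' // v.IsReal} => ρ jv.2 jv.1)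
    (fun _ => (1 : ℝ)) with hε
  rw [archFolland_apply, archFolland_apply]
  refine Prod.ext (frame3_mul E' c' N' hc' p wOf₁ hw₁ wOf hover t₀ ht0 hcδ' hδ' ρ a) ?_
  change follandFreq F' (Fin N') _ (archMat F' (Fin N') T *ᵥ (r * w)) = εt * follandFreq F' (Fin N') _ (archMat F' (Fin N') T *ᵥ w)
  rw [hT, diagonal_mulVec_mul]
  set w' := Matrix.diagonal dT *ᵥ w with hw'
  refine eq_of_forall_dotProduct_frame_eq N' (frame3 E' c' N' hc' p wOf₁ hw₁ wOf hover t₀ ht0 hcδ' hδ') fun u => ?_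
  rw [follandFreq_dotProduct_apply, piTracePairing_mul_right]
  have h2 : (εt * follandFreq F' (Fin N') (frame3 E' c' N' hc' p wOf₁ hw₁ wOf hover t₀ ht0 hcδ' hδ') w') ⬝ᵥ
      (frame3 E' c' N' hc' p wOf₁ hw₁ wOf hover t₀ ht0 hcδ' hδ') u =
      follandFreq F' (Fin N') (frame3 E' c' N' hc' p wOf₁ hw₁ wOf hover t₀ ht0 hcδ' hδ') w' ⬝ᵥ
        (εt * (frame3 E' c' N' hc' p wOf₁ hw₁ wOf hover t₀ ht0 hcδ' hδ') u) := by
    simp only [dotProduct, Pi.mul_apply]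
    exact Finset.sum_congr rfl fun k _ => by ring
  rw [h2, hε, ← frame3_mul E' c' N' hc' p wOf₁ hw₁ wOf hover t₀ ht0 hcδ' hδ' ρ u, ← hr, follandFreq_dotProduct_apply]

end Frame

end Literature.NumberTheory.Weil1964

end
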